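import Literature.NumberTheory.Automorphic.QuaternionUnitsTraceClasses
import Literature.NumberTheory.Automorphic.GLnIwasawaIntegration
import HarnessLib

/-!
# The trace formula for `D^×` in Hilbert–Schmidt form:
`Σ_i ‖R(f) e_i‖² = c⁻¹ κ Σ_{[γ]} d_{[γ]} ∫_{G ⧸ G_γ} (f ⋆ f^*)_A(y γ y⁻¹) dμ_γ(y)`
(Gelbart, *Automorphic forms on adele groups* (1975), (9.11)–(9.13), Lemma 10.6, Remark 9.23,
(10.14))

Topic `NumberTheory/Automorphic`; theorems only. Final assembly, on the side of the division
quaternion algebra `D`, of the inline (D-0026) decomposition of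
`Literature.NumberTheory.Automorphic.strong_multiplicity_one_quaternionUnits`: the landed
Hilbert–Schmidt identity `Σ_i ‖R(f) e_i‖² = c⁻¹ ∫_X K_{f ⋆ f^*}(x, x) dμ(x)`
(`AdelicGroupData.hasSum_norm_sq_integratedOperator_rightRegular_eq_diagonal`,
`AutomorphicQuotientKernelConvolution`; Gelbart (9.11) with Lemma 10.6) combined with the
geometric side for `D^×` (`units_integral_quotientKernel_diag_eq_mul_tsum`,
`QuaternionUnitsTraceClasses`; Gelbart (9.13), Remark 9.23) gives, for every `f ∈ C_c(D_𝔸ˣ)`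
and every Hilbert basis `(e_i)` of `L²(X)`, `X = D_𝔸ˣ ⧸ ℝ_{>0} Dˣ`:

  `Σ_i ‖R(f) e_i‖² = c⁻¹ κ Σ'_{[γ]} d_{[γ]} ∫_{G ⧸ G_γ} (f ⋆ f^*)_A(y γ y⁻¹) dμ_γ(y)`

(`units_hasSum_norm_sq_integratedOperator_rightRegular_eq_geometric`), the geometric expansion
of the Hilbert–Schmidt norm of `R(f)` — the form of Gelbart's (10.14) that avoids trace-class
theory (the left-hand side is `tr R(f ⋆ f^*) = Σ_π m(π) tr π(f) π(f)^*` once `R` is decomposed,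
which is not done here). Also: Haar measures on `D_𝔸ˣ` are inversion invariant
(`units_isInvInvariant_of_isHaarMeasure`: unimodularity, `QuaternionUnitsTraceClasses`, and
`isInvInvariant_of_isMulRightInvariant`).

CAVEAT: the constants `c` (unfolding constant), `κ`, `d_{[γ]}` and the measures `μ_γ` are not
normalised; the spectral side and the comparison with `GL(2)` (Gelbart §10) are not treated.

## References

* S. Gelbart, *Automorphic forms on adele groups*, Ann. of Math. Studies 83 (1975), §9
  (9.11)–(9.13), Lemma 10.6, Remark 9.23, (10.14) [Gelbart1975].
-/

noncomputable section

open NumberField IsDedekindDomain MeasureTheory Measure Topology CompactlySupported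
open Literature.MeasureTheory.Group
open scoped NNReal ENNReal

namespace Literature.NumberTheory.Automorphic

-- the coset spaces carry Borel σ-algebras supplied locally, not the quotient σ-algebra
attribute [-instance] Quotient.instMeasurableSpace QuotientGroup.measurableSpace

universe u

variable (K : Type) [Field K] [NumberField K] (D : Type u) [Ring D] [Algebra K D]
  [IsQuaternionAlgebra K D]
  [MeasurableSpace (AdelicGroupData.units K D).Adelic] [BorelSpace (AdelicGroupData.units K D).Adelic]
  [∀ γ : (AdelicGroupData.units K D).Adelic, MeasurableSpace ((AdelicGroupData.units K D).Adelic ⧸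
    Subgroup.centralizer ({γ} : Set (AdelicGroupData.units K D).Adelic))]
  [∀ γ : (AdelicGroupData.units K D).Adelic, BorelSpace ((AdelicGroupData.units K D).Adelic ⧸
    Subgroup.centralizer ({γ} : Set (AdelicGroupData.units K D).Adelic))]
  [∀ γ : (AdelicGroupData.units K D).Adelic, MeasurableSpace ((AdelicGroupData.units K D).Adelic ⧸
    ((AdelicGroupData.units K D).quotientSubgroup ⊓
      Subgroup.centralizer ({γ} : Set (AdelicGroupData.units K D).Adelic)))]
  [∀ γ : (AdelicGroupData.units K D).Adelic, BorelSpace ((AdelicGroupData.units K D).Adelic ⧸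
    ((AdelicGroupData.units K D).quotientSubgroup ⊓
      Subgroup.centralizer ({γ} : Set (AdelicGroupData.units K D).Adelic)))]

attribute [local instance] AdelicGroupData.measurableSpaceQuotientForm
  AdelicGroupData.borelSpaceQuotientForm AdelicGroupData.smulInvariantMeasureQuotientForm
  AdelicGroupData.isFiniteMeasureOnCompactsQuotientForm AdelicGroupData.isFiniteMeasureQuotientForm

local notation "GD" => AdelicGroupData.units K D

omit [∀ γ : (AdelicGroupData.units K D).Adelic, MeasurableSpace ((AdelicGroupData.units K D).Adelic ⧸
    Subgroup.centralizer ({γ} : Set (AdelicGroupData.units K D).Adelic))]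
  [∀ γ : (AdelicGroupData.units K D).Adelic, BorelSpace ((AdelicGroupData.units K D).Adelic ⧸
    Subgroup.centralizer ({γ} : Set (AdelicGroupData.units K D).Adelic))]
  [∀ γ : (AdelicGroupData.units K D).Adelic, MeasurableSpace ((AdelicGroupData.units K D).Adelic ⧸
    ((AdelicGroupData.units K D).quotientSubgroup ⊓
      Subgroup.centralizer ({γ} : Set (AdelicGroupData.units K D).Adelic)))]
  [∀ γ : (AdelicGroupData.units K D).Adelic, BorelSpace ((AdelicGroupData.units K D).Adelic ⧸
    ((AdelicGroupData.units K D).quotientSubgroup ⊓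
      Subgroup.centralizer ({γ} : Set (AdelicGroupData.units K D).Adelic)))] in
/-- **Haar measures on `D_𝔸ˣ` are inversion invariant** (`D_𝔸ˣ` is unimodular,
`units_isMulRightInvariant_of_isHaarMeasure`, and a two-sided Haar measure of a second countable
locally compact group is inversion invariant, `isInvInvariant_of_isMulRightInvariant`).
[cite: Gelbart1975, Remark 9.23] -/
theorem units_isInvInvariant_of_isHaarMeasure (hdiv : ∀ x : D, x ≠ 0 → IsUnit x)
    (ν : Measure (GD).Adelic) [IsHaarMeasure ν] : ν.IsInvInvariant := by
  obtain ⟨i₁, i₂, i₃⟩ := units_adelic_topology K D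
  haveI := i₁; haveI := i₂; haveI := i₃
  haveI := units_isMulRightInvariant_of_isHaarMeasure K D hdiv ν
  exact isInvInvariant_of_isMulRightInvariant ν

/-- **The trace formula for `D^×` in Hilbert–Schmidt form** (Gelbart (1975), (9.11)–(9.13) with
Lemma 10.6 and Remark 9.23; the shape of (10.14)). Let `D` be a division quaternion algebra over
the number field `K`, `𝒢 = AdelicGroupData.units K D`, `X = D_𝔸ˣ ⧸ ℝ_{>0} Dˣ` (compact), `μ` an
automorphic measure, `α`, `ρ`, `ν` Haar measures on `ℝ_{>0}`, `L = ℝ_{>0} Dˣ`, `D_𝔸ˣ` (all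
two-sided; the instance binders hold by `units_adelic_topology`, `isClosed_quotientSubgroup_units`,
`isMulRightInvariant_quotientSubgroup_units`, `units_isInvInvariant_of_isHaarMeasure`). Then there
are `κ > 0`, `d_c ∈ (0, ∞)` and non-zero invariant measures `μ_c` on `G ⧸ C_G(γ_c)`
(`γ_c = out c`, `c` the conjugacy classes of `Dˣ`) such that for every `f ∈ C_c(D_𝔸ˣ)` and every
Hilbert basis `(e_i)` of `L²(X, μ)`:

  `Σ_i ‖R(f) e_i‖² = c⁻¹ κ Σ'_c d_c ∫_{G ⧸ C_G(γ_c)} (f ⋆ f^*)_A(y γ_c y⁻¹) dμ_c(y)`,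

`c = unfoldingConstant L ρ μ ν`, `(f ⋆ f^*)_A(g) = ∫_{A_G} (f ⋆ f^*)(a⁻¹ g) dα`, the series
converging (absolutely, by `units_integral_quotientKernel_diag_eq_mul_tsum`). Left-hand side:
`hasSum_norm_sq_integratedOperator_rightRegular_eq_diagonal`; right-hand side: the geometric side
for `Φ = f ⋆ f^* ∈ C_c(D_𝔸ˣ)`. CAVEAT: constants and measures are not normalised; no spectral
decomposition is asserted. [cite: Gelbart1975, (9.11)–(9.13), Lemma 10.6 and Remark 9.23] -/
theorem units_hasSum_norm_sq_integratedOperator_rightRegular_eq_geometric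
    (hdiv : ∀ x : D, x ≠ 0 → IsUnit x)
    [LocallyCompactSpace (GD).Adelic] [SecondCountableTopology (GD).Adelic] [T2Space (GD).Adelic]
    [hH : IsClosed ((GD).quotientSubgroup : Set (GD).Adelic)]
    (μ : Measure (GD).automorphicQuotient) [(GD).IsAutomorphicMeasure μ]
    (α : Measure (GD).center') [α.IsHaarMeasure] [SFinite α]
    (ρ : Measure (GD).quotientSubgroup) [ρ.IsHaarMeasure] [ρ.IsMulRightInvariant]
    [ρ.IsInvInvariant] [SFinite ρ]
    (ν : Measure (GD).Adelic) [IsHaarMeasure ν] [ν.IsInvInvariant] :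
    ∃ (κ : ℝ≥0) (dc : ConjClasses (GD).arithmeticSubgroup → ℝ≥0∞)
      (μC : ∀ c : ConjClasses (GD).arithmeticSubgroup, Measure ((GD).Adelic ⧸
        Subgroup.centralizer ({((Quotient.out c : (GD).arithmeticSubgroup) : (GD).Adelic)} :
          Set (GD).Adelic))),
      0 < κ ∧ (∀ c, dc c ≠ 0 ∧ dc c ≠ ∞) ∧
      (∀ c, SMulInvariantMeasure (GD).Adelic _ (μC c) ∧ IsFiniteMeasureOnCompacts (μC c) ∧
        μC c ≠ 0) ∧
      ∀ (f : CompactlySupportedContinuousMap (GD).Adelic ℂ) {ι : Type*} [Countable ι]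
        (b : HilbertBasis ι ℂ ((GD).L2 μ)),
        HasSum (fun i => ((‖((GD).rightRegular μ).integratedOperator ((GD).isUnitary_rightRegular μ)
            ((GD).isStronglyContinuous_rightRegular_holds μ) ν f (b i)‖ ^ 2 : ℝ) : ℂ))
          ((((unfoldingConstant (GD).quotientSubgroup ρ μ ν : ℝ)⁻¹ : ℂ)) *
            (((κ : ℝ) : ℂ) * ∑' c, ((dc c).toReal : ℂ) * ∫ y, descConj
              ((Quotient.out c : (GD).arithmeticSubgroup) : (GD).Adelic)
              (Subgroup.centralizer ({((Quotient.out c : (GD).arithmeticSubgroup) : (GD).Adelic)} :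
                Set (GD).Adelic)) (mem_centralizer_singleton_comm _)
              (fun g => ∫ a, mulConv ν f (mulStar f) ((a : (GD).Adelic)⁻¹ * g) ∂α) y ∂(μC c))) := by
  have hρ0 : ρ ≠ 0 := fun h => by
    have h2 : 0 < ρ Set.univ := isOpen_univ.measure_pos ρ ⟨1, trivial⟩
    rw [h] at h2
    exact lt_irrefl _ h2
  obtain ⟨κ, dc, μC, hκ, hdc, hμC, hgeo⟩ :=
    units_integral_quotientKernel_diag_eq_mul_tsum K D hdiv μ α ρ
  refine ⟨κ, dc, μC, hκ, hdc, hμC, fun f ι _ b => ?_⟩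
  -- `Φ = f ⋆ f^* ∈ C_c(D_𝔸ˣ)`
  set Φ : CompactlySupportedContinuousMap (GD).Adelic ℂ :=
    ⟨⟨mulConv ν f (mulStar f), continuous_mulConv ν f.continuous f.hasCompactSupport
      (continuous_mulStar f.continuous)⟩,
      hasCompactSupport_mulConv ν f.hasCompactSupport (hasCompactSupport_mulStar f.hasCompactSupport)⟩
    with hΦ
  haveI : CompactSpace (GD).automorphicQuotient :=
    AdelicGroupData.compactSpace_automorphicQuotient_units_holds K D hdiv
  have h1 := AdelicGroupData.hasSum_norm_sq_integratedOperator_rightRegular_eq_diagonal (GD) μ ρ ν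
    hρ0 f b
  have h2 : ∫ x, quotientKernel (GD).quotientSubgroup ρ (mulConv ν f (mulStar f)) x x ∂μ =
      ((κ : ℝ) : ℂ) * ∑' c, ((dc c).toReal : ℂ) * ∫ y, descConj
        ((Quotient.out c : (GD).arithmeticSubgroup) : (GD).Adelic)
        (Subgroup.centralizer ({((Quotient.out c : (GD).arithmeticSubgroup) : (GD).Adelic)} :
          Set (GD).Adelic)) (mem_centralizer_singleton_comm _)
        (fun g => ∫ a, mulConv ν f (mulStar f) ((a : (GD).Adelic)⁻¹ * g) ∂α) y ∂(μC c) :=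
    (hgeo Φ).2.2
  rwa [h2] at h1

end Literature.NumberTheory.Automorphic
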